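import Summits.BirchSwinnertonDyer.BirchSwinnertonDyer.Theses.SignedLowerHalves
import Summits.BirchSwinnertonDyer.BirchSwinnertonDyer.Theorems.SignedLowerHalvesKobayashiLowerHalfSemistableDefmuOddPrimeThree
import HarnessLib

/-!
# Line «defmu» — REGISTERED SKELETON v6 of crux 2 `KobayashiLowerHalfSemistable` (stmt-BirchSwinnertonDyer-19000):
# v5's VARIANT-N shape (two CITE STUBS, print BY NAME) with the last content stub — the `p = 3` residual S7 `stub_threeResidual` —
# RE-ITEMISED into two PRINT stubs awaiting Literature typing (`stub_bstw617OddPrime`: BSTW Thm 6.17 at an odd supersingular prime,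
# PREPRINT, referee-flagged at 3; `stub_pollackWestonLemma21`: Pollack–Weston 2011 Lemma 2.1, PUBLISHED) and CLOSED IN-FILE by name
# (`threeResidual_closed`). Four registered stubs, ZERO research stubs; composition BY NAME through the landed `Theorems/` assembly.

LEAD bsd-line-slh-p2 gen 18 (prover-bsd-line-slh-p2-g18-0), 2026-08-29. v5 = crux commit 5b2ee38cb7f5 / sha256 e3c25bd1… (this seat, 13:33Z;
stubs `stub_publishedInputs` · `stub_preprintInputs` · `stub_threeResidual`). v6 = v5 + the FINDING of `Lines/defmu-at-three.md` made kernel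
fact by the «defmu AT AN ODD PRIME» series of `Theorems` files (this seat; route-independent; `--supports 19000 --as helper`):
`…DefmuOddPrimeFrame.lean` (p723224: `definiteFieldSupplyFromR_odd`, `ramifiedLevelPrimeR_odd_of_levelLowering` — S1bʳ/S1aʳ at `p ≠ 2`,
the landed proofs verbatim), `…DefmuOddPrimeDescent.lean` (p723658: `kobayashiMainConjecture_of_twoVariableDvd_odd` — the descent at `p ≠ 2`
with the period unit from MAZUR Cor. 4.1 —, `exists_kobayashiLowerDivisibility_odd_of_package` — p629660 §3 at odd `p` with `a_p = 0`),
`…DefmuOddPrimeThree.lean` (`definitePackageMuCarrier_odd_of_pinned`, `exists_package_odd_of_muCarrier`, and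
`threeResidual_of_citePacks : ⟨publishedInputs⟩ → ⟨preprintInputs⟩ → ⟨BSTW 6.17 at odd p⟩ → ⟨PW Lemma 2.1⟩ → ⟨stub_threeResidual VERBATIM⟩`).
In the landed `5 ≤ p` chain the hypothesis `5 ≤ p` was used ONLY through `p ≠ 2`, `a_p = 0`, the TYPING of two named facts at `5 ≤ p`
(BSTW 6.17; the period unit) and PW's Lemma 2.1 normalisation being automatic (weights ∣ 12): so the line HAS a mechanism at `p = 3`.

PER-STUB TOKENS (v5 → v6), director (390)(3) format:
* `stub_publishedInputs` (7 PUB names) and `stub_preprintInputs` (3 PRE names): UNCHANGED, CITE-ONLY.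
* `stub_threeResidual` (S7) = MIXED → two PRINT-UNTYPED stubs + in-file `threeResidual_closed`:
  - `stub_bstw617OddPrime` = BSTW Thm 6.17 at odd supersingular `p` with `a_p = 0` (the typed binder's text with `5 ≤ p ↦ p ≠ 2`; print §1.2
    (h4)); PREPRINT; at `p = 3` = the cell's referee residual (3-ii)♭′ + B1 (bstw-MEMO-10) — typing target F-new-1, NEVER a bench target;
  - `stub_pollackWestonLemma21` = Pollack–Weston 2011 §2.1 Lemma 2.1 in the tree's currency under PW's (CR) (PUBLISHED) — typing target F-new-2,
    and plausibly PROVABLE from the tree's Takahashi dictionary (bench candidate: «p9 bench: 19000 stub_pollackWestonLemma21»).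
* v4's `stub_ramifiedLevelPrimeR` / `stub_definitePackageMuCarrier` / `stub_acMuInput` / `stub_namedInputsTwo`: in-file `…_closed` as in v5.

Composition: `KobayashiLowerHalfSemistable_of` is the term `SemistableDefmuMuCarrierV4.kobayashiLowerHalfSemistable_body_of_stubs₅
ramifiedLevelPrimeR_closed definitePackageMuCarrier_closed acMuInput_closed namedInputsTwo_closed threeResidual_closed` (equivalently
`SemistableDefmuOddPrime.kobayashiLowerHalfSemistable_body_of_citePacks_odd stub_publishedInputs stub_preprintInputs stub_bstw617OddPrime
stub_pollackWestonLemma21`) through landed, route-independent `Theorems` files only (`…DefmuOddPrime{Frame,Descent,Three}` ← `…DefmuMuCarrierPinned`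
(p722021/p722689) ← `…DefmuMuCarrierV4` (p638422) ← `…DefmuMuCarrier` (p637155) ← `…DefmuAssemblyStubs` (p630247) ← `…DefmuAssembly` (p629660),
`…DefiniteFrameData` (p625235/p625644)); the route file enters only through line 1. So `ledger skeleton check` certifies that the
permanent-tree assembly closes the crux BY NAME modulo exactly the four registered stubs.

Stub ledger (numbers, not adjectives): registered stubs 4 = cite-only 2 (10 typed names: PUB 7, PRE 3) + print-untyped 2 (PRE 1, PUB 1) +
research 0 · kernel-closable today 0 (`stub_pollackWestonLemma21` is the one candidate) · READING (director (390)(1)(iii)): crux 2 AS A WHOLE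
is «closed mod print: Kobayashi2003.thm12, thm41, nonempty_modularParametrizationData, takahashi2001_brandtEigenLattice_rank_one,
mazur_not_dvd_maninConstant_of_odd, diamond1995_refinedSerre, pollackWeston2011_thm_2_5_hasMuZeroLAc (PUB, typed); thm617_…_PRE, thm924_…_OPEN,
thm105def_…_PRE (PRE, typed); BSTW Thm 6.17 at odd p (PRE, untyped, referee-flagged at 3); PW Lemma 2.1 (PUB, untyped)» — 12 printed statements,
NO research residual. The ledger item stays OPEN (PRE): nothing about any curve is asserted; BSD / the crux NOT proved. The line's design,
mechanism, provenance and barrier story: `DefanchorLine.lean` (rev 5) / `DefanchorLine.md` (v7) / `Lines/defmu.md` / `Lines/defmu-at-three.md` /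
`PICKED.md`. Revert to v5 = `ledger crux write stmt-BirchSwinnertonDyer-19000 Lines/defmu.lean --file <v5>` + `ledger skeleton check`
(v5 = crux commit 5b2ee38cb7f5, sha256 e3c25bd1…).
-/

-- D-0017: single-problem summit, the namespace repeats the problem name by design.
set_option linter.dupNamespace false
set_option autoImplicit false

noncomputable section

open scoped Classical

open NumberField IsDedekindDomain Field CongruenceSubgroup
open Literature.NumberTheory.GaloisRepresentations
open Literature.NumberTheory.EllipticCurves Literature.NumberTheory.EllipticCurves.BurungaleSkinnerTianWan2024
open Literature.NumberTheory.EllipticCurves.ModularForms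
open Literature.NumberTheory.Automorphic

namespace Summit.BirchSwinnertonDyer.BirchSwinnertonDyer.Cruxes.KobayashiLowerHalfSemistable.DefanchorLine

/-! ### The four registered stubs: two CITE STUBS (typed print BY NAME) and two PRINT stubs awaiting typing — no research stub -/

section Registered

/-- **cite stub `publishedInputs`** [CITE-ONLY — never a proof target, never benched, never counted]: the REFEREED print inputs of
line «defmu», each a typed named fact of the tree, BY NAME — Kobayashi 2003 Thm. 1.2 (`X^ε` finitely generated torsion) ∧ Thm. 4.1
(`(L_p^ε) ⊆ char X^ε`) ∧ modularity (a parametrisation datum at level `N_E`: Wiles / BCDT) ∧ multiplicity one for the Brandt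
eigen-lattice (Takahashi 2001 p. 78 / Pizer 1980 Thm. 2.28; its discharge `takahashi2001_brandtEigenLattice_rank_one_holds` IS a tree theorem —
Eichler–Selberg, `TakahashiDegreeFormulaFromDictionaryHolds` — whose module chain is UNBUILT on the farm at 2026-08-29T13:20Z, so the fact is
cited BY NAME; supplies the generator `φ` of Cμ′'s carrier) ∧ Mazur 1978 Cor. 4.1 (the Manin constant is a unit at odd `p ∥ N`; supplies the
period unit via `realPeriodRat_eq_unit_mul_plusPeriod_of_mazur`) ∧ Diamond 1995 Thm. 1.1 (refined Serre /
Ribet level lowering; supplies S1aʳ) ∧ Pollack–Weston 2011 Thm. 2.5 (i) (`μ(L_n) = 0`, `n ≫ 0`, for every definite configuration; = v4's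
`stub_acMuInput`). Closed iff each fact is discharged (`_holds`). [cite: Kobayashi2003, Thm. 1.2, Thm. 4.1] [cite: BCDTJAMS2001, Thm. A]
[cite: Takahashi2001, §2 p. 78] [cite: Mazur1978, Cor. 4.1] [cite: Diamond1995RefinedSerre, Thm. 1.1] [cite: PollackWeston2011, Thm. 2.5 (i)] -/
theorem stub_publishedInputs :
    Kobayashi2003.thm12_signedSelmerDual_finite_torsion ∧ Kobayashi2003.thm41_signedCharIdeal_divisibility ∧
      nonempty_modularParametrizationData ∧ takahashi2001_brandtEigenLattice_rank_one ∧
      mazur_not_dvd_maninConstant_of_odd ∧ Literature.NumberTheory.Automorphic.diamond1995_refinedSerre ∧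
      (∀ (K : Type) [Field K] [NumberField K] {Nplus Nminus : ℕ} (S : Brandt.XiSetup Nplus Nminus)
        (p : ℕ) [Fact p.Prime] (W : WeierstrassCurve ℚ), pollackWeston2011_thm_2_5_hasMuZeroLAc K S p W) := by
  sorry

/-- **cite stub `preprintInputs`** [CITE-ONLY — never a proof target, never benched, never counted]: the UNREFEREED-PREPRINT inputs
of line «defmu» (Burungale–Skinner–Tian–Wan, arXiv:2409.01350v2), each an explicitly labelled OPEN binder of the tree (claim-tagged,
NEVER a theorem), BY NAME — Thm. 6.17 (the signed Greenberg `𝓛`-function exists on every frame at a supersingular prime) ∧ Thm. 9.24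
(GMC_r: Greenberg divisibility away from the cyclotomic variable) ∧ Part II Thm. 10.5 proof, case (def) (the signed two-variable package
pinned to Gross points: the `μ`-shadow of `(𝓛^{∘,ac}_p) = (∏ c_q · 𝓛^∘_𝒲)`; supplies Cμ′). Closed iff the preprint claims are refereed
AND proved in the tree. [claim: BurungaleSkinnerTianWan2024, status: under-review]
[cite: BurungaleSkinnerTianWan2024, Thm. 6.17, Thm. 9.24, Part II Thm. 10.5 proof case (def) (arXiv:2409.01350v2; ANNOUNCED, OPEN binders)] -/
theorem stub_preprintInputs :
    thm617_exists_isGreenbergLFunctionAnyRoot₂_supersingular_PRE ∧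
      thm924_greenberg_dvd_charIdealXGr₂_awayFromCyc_OPEN ∧
      thm105def_exists_signedTwoVariablePackage_pinnedToGrossPoints_supersingular_PRE := by
  sorry

/-- **stub `bstw617OddPrime`** [PRINT, UNTYPED — a literature seat's typing target (F-new-1), NOT a research target]: BSTW
arXiv:2409.01350v2 Thm. 6.17 (the Katz frame and the signed Greenberg `p`-adic `L`-function `𝓛_p^Gr(f/K)` exist) at an ODD supersingular
prime with `a_p = 0` — the text of the tree's binder `thm617_exists_isGreenbergLFunctionAnyRoot₂_supersingular_PRE` with its convenience
restriction `5 ≤ p` replaced by print's `p ≠ 2` (§1.2: "`p ∤ 2N`", (h4) "`a_p(E) = 0` if `p = 3`"). UNREFEREED PREPRINT CLAIM; at `p = 3`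
it is exactly where the cell's referees located the residual (3-ii)♭′ + B1 (bstw-MEMO-10: the Eisenstein-inclusive Λ-adic Eichler–Shimura
input behind Thms 4.5–4.11). Used ONLY for the `p = 3` half (`threeResidual_closed`); the `5 ≤ p` half cites the typed binder by name.
[claim: BurungaleSkinnerTianWan2024, status: under-review] [cite: BurungaleSkinnerTianWan2024, Thm. 6.17 with §1.2 (h1)–(h4) (arXiv:2409.01350v2; ANNOUNCED)] -/
theorem stub_bstw617OddPrime :
      ∀ {p : ℕ} [Fact p.Prime] (ι : PadicAlgCl p ≃+* ℂ) (W : WeierstrassCurve ℚ) [W.IsElliptic]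
        [W.IsGloballyMinimal] (K : Type) [Field K] [NumberField K] (v vbar : HeightOneSpectrum (𝓞 K))
        (κ₁ κ₂ : ZpExtension K p) (γ₁ γ₂ : absoluteGaloisGroup K)
        [Fact (ZpExtension.IsTopGeneratorPair κ₁ κ₂ γ₁ γ₂)] {N : ℕ} [NeZero N] {f : CuspForm (Gamma0 N) 2}
        (_ : IsNewformOf W f) [NeZero (NumberField.discr K).natAbs],
        -- `g = f_E` of level `N = N_E`; `p` ODD of good SUPERSINGULAR reduction: `p ∤ N_E`, `a_p(E) = 0`
        (N : ℤ) = W.conductorNorm ℤ → p ≠ 2 → ¬ (p : ℤ) ∣ W.conductorNorm ℤ → W.frobeniusTrace p = 0 →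
        -- `L = K` imaginary quadratic; (h2) `p = v v̄` split, `v` induced by `ι`; (h1) `(N, D_K) = 1`
        IsImaginaryQuadratic K → ((Ideal.span {(p : ℤ)}).primesOver (𝓞 K)).ncard = 2 →
        ((p : ℕ) : 𝓞 K) ∈ v.asIdeal → ((p : ℕ) : 𝓞 K) ∈ vbar.asIdeal → vbar ≠ v →
        (∀ (w : InfinitePlace K) (k : 𝓞 K), k ∈ v.asIdeal ↔ ‖ι.symm (w.embedding (k : K))‖ < 1) →
        IsCoprime (N : ℤ) (NumberField.discr K) →
        -- the `ℤ_p²`-tower: `κ₁` cyclotomic, `κ₂` anticyclotomic, generator pair `(γ₁, γ₂)`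
        κ₁.IsCyclotomic → κ₂.IsAnticyclotomic →
        -- a Katz frame (period data + Katz's two-variable measure) and `G = 𝓛_p^Gr(f/K)` in it
        ∃ (Ω δ : ℂ) (Ωp : (unrIntegers p)ˣ) (LK G : PowerSeries (PowerSeries (PadicComplexInt p))),
          Ω ≠ 0 ∧ (δ ^ 2 = (NumberField.discr K : ℂ) ∨ δ ^ 2 = -(NumberField.discr K : ℂ)) ∧
          IsKatzMeasure₂ ι v vbar ∅ κ₁ κ₂ γ₁⁻¹ γ₂⁻¹ 1 Ω δ ((Ωp : unrIntegers p) : ℂ_[p]) LK ∧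
          IsGreenbergLFunctionAnyRoot₂ ι v vbar κ₁ κ₂ γ₁⁻¹ γ₂⁻¹ f (NumberField.discr K).natAbs
            (NumberField.classNumber K) LK G := by
  sorry

/-- **stub `pollackWestonLemma21`** [PRINT (PUBLISHED), UNTYPED — typing target (F-new-2); plausibly PROVABLE in the tree from the Takahashi
character-group dictionary (`takahashi2001_characterGroupDictionary`, `RibetTakahashiDefinitePrime`), hence also benchable]: Pollack–Weston
2011, Compos. Math. 147, §2.1 Lemma 2.1 — "There is some `m ∈ M` such that `⟨m, g_f⟩` is a unit" (proof: §6.3, from Takahashi via Prop. 6.4)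
—, in the tree's currency `∃ c, p ∤ w_c φ_c` for a generator `φ` of the `a(E)`-eigen-line of the Brandt module (the normalisation hypothesis
`hnorm` of `pollackWeston2011_thm_2_5_hasMuZeroLAc`), under PW's standing hypotheses (p. 2): `N = N⁺N⁻` square-free, `p` odd, `p ∤ N`,
(CR) `ρ̄_{E,p}` surjective and ramified at the primes of `N⁻` (here: `p ∤ v_q(Δ_E)` at every `q ∣ N⁻`; at `p = 3` this IS (CR), every
`q ≠ 3` being `≡ ±1 (mod 3)`). At `p ≥ 5` the conclusion is the tree THEOREM `SemistableDefmuMuCarrierV4.exists_not_dvd_weight_mul_apply`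
for every setup (weights ∣ 12); the stub matters at `p = 3` only. [cite: PollackWeston2011, §2.1 Lemma 2.1 and §6.3] [cite: Takahashi2001, Thm. 2.3] -/
theorem stub_pollackWestonLemma21 :
    ∀ (p : ℕ) [Fact p.Prime] (W : WeierstrassCurve ℚ) [W.IsElliptic] [W.IsGloballyMinimal]
      {Nplus Nminus : ℕ} (S : Brandt.XiSetup Nplus Nminus) [Fintype (Brandt.ClassSet S.O)],
      p ≠ 2 → Nplus * Nminus = W.conductorNorm ℤ → Squarefree (Nplus * Nminus) → ¬ p ∣ Nplus * Nminus →
      Rank1Residual.Surj W p → (∀ q : ℕ, q.Prime → q ∣ Nminus → ¬ ((p : ℤ) ∣ padicValRat q W.Δ)) →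
      ∀ (φ : Brandt.ClassSet S.O → ℤ), φ ≠ 0 →
        Brandt.eigenLattice (Nplus * Nminus) (Brandt.matrix S.O) (fun n => W.LFunction n) = ℤ ∙ φ →
        ∃ c : Brandt.ClassSet S.O, ¬ (p : ℤ) ∣ (Brandt.weight S.O c : ℤ) * φ c := by
  sorry

end Registered

/-! ### The five v1–v5 content/mixed stubs, CLOSED IN-FILE by name from the registered stubs (director (390)(1)(ii): "conditional
parts → in-file `…_closed` theorems by name") -/

section Closed

/-- **v4's `stub_ramifiedLevelPrimeR` (S1aʳ; signature VERBATIM) CLOSED by name**: the tree theorem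
`SemistableDefiniteFrameData.ramifiedLevelPrimeR_of_levelLowering` (p625644) at modularity (`exists_isNewformOf` from the parametrisation
datum, `exists_isNewformOf_of_nonempty_modularParametrizationData`) and Diamond 1995, both conjuncts of `stub_publishedInputs`.
[cite: Ribet1990, Thm. 1.1] [cite: Diamond1995RefinedSerre, Thm. 1.1] -/
theorem ramifiedLevelPrimeR_closed :
  ∀ (p : ℕ) [Fact p.Prime] (W : WeierstrassCurve ℚ) [W.IsElliptic] [W.IsGloballyMinimal],
    5 ≤ p → Rank1Residual.ClassX6 W p →
    ∃ q₀ : ℕ, q₀.Prime ∧ (q₀ : ℤ) ∣ W.conductorNorm ℤ ∧ ¬ ((p : ℤ) ∣ padicValRat q₀ W.Δ) :=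
  Summit.BirchSwinnertonDyer.BirchSwinnertonDyer.Theorems.SemistableDefiniteFrameData.ramifiedLevelPrimeR_of_levelLowering
    (exists_isNewformOf_of_nonempty_modularParametrizationData stub_publishedInputs.2.2.1) stub_publishedInputs.2.2.2.2.2.1

/-- **v4's `stub_definitePackageMuCarrier` (Cμ′, the HARD stub; signature VERBATIM) CLOSED by name**: this seat's
`SemistableDefmuMuCarrierPinned.definitePackageMuCarrier_of_pinned` at the (P4b) binder (conjunct 3 of `stub_preprintInputs`), modularity and
multiplicity one (conjuncts 3, 4 of `stub_publishedInputs`); the carrier `(S, φ, T)` is supplied from proved theorems of the tree.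
[claim: BurungaleSkinnerTianWan2024, status: under-review] [cite: BurungaleSkinnerTianWan2024, Part II Thm. 10.5 proof, case (def)]
[cite: Takahashi2001, §2 p. 78] [cite: BertoliniDarmon1996, Lemma 2.2 and §2.4] -/
theorem definitePackageMuCarrier_closed :
  ∀ {p : ℕ} [Fact p.Prime] (ι : PadicAlgCl p ≃+* ℂ) (W : WeierstrassCurve ℚ) [W.IsElliptic]
    [W.IsGloballyMinimal] (K : Type) [Field K] [NumberField K] (v vbar : HeightOneSpectrum (𝓞 K))
    (κ₁ κ₂ : ZpExtension K p) (γ₁ γ₂ : absoluteGaloisGroup K)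
    [Fact (ZpExtension.IsTopGeneratorPair κ₁ κ₂ γ₁ γ₂)] {N : ℕ} [NeZero N] (f : CuspForm (Gamma0 N) 2)
    [NeZero (NumberField.discr K).natAbs],
    IsNewformOf W f → (N : ℤ) = W.conductorNorm ℤ → p ≠ 2 → ¬ (p : ℤ) ∣ W.conductorNorm ℤ →
    W.frobeniusTrace p = 0 →
    IsImaginaryQuadratic K → ((Ideal.span {(p : ℤ)}).primesOver (𝓞 K)).ncard = 2 →
    ((p : ℕ) : 𝓞 K) ∈ v.asIdeal → ((p : ℕ) : 𝓞 K) ∈ vbar.asIdeal → vbar ≠ v →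
    (∀ (w : InfinitePlace K) (k : 𝓞 K), k ∈ v.asIdeal ↔ ‖ι.symm (w.embedding (k : K))‖ < 1) →
    IsCoprime (N : ℤ) (NumberField.discr K) →
    -- ⟨definite-CR datum, rev 5: X6 at 5 ≤ p; ONE prime q₀ ∥ N inert in K, every other ℓ ∣ N split; `2` split or
    --  `2 ∣ N` ((spl) of BSTW Thm 9.24); (CR, RAMIFIED branch only) `p ∤ v_{q₀}(Δ_W)` (ρ̄ ramified at q₀, `p ∤ c_{q₀}`)⟩
    5 ≤ p → Rank1Residual.ClassX6 W p →
    ∀ q₀ : ℕ, q₀.Prime → q₀ ∣ N → ¬ (q₀ ^ 2 ∣ N) →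
      ((Ideal.span {(q₀ : ℤ)}).primesOver (𝓞 K)).ncard = 1 →
      (∀ ℓ : ℕ, ℓ.Prime → ℓ ∣ N → ℓ ≠ q₀ → ((Ideal.span {(ℓ : ℤ)}).primesOver (𝓞 K)).ncard = 2) →
      (((Ideal.span {(2 : ℤ)}).primesOver (𝓞 K)).ncard = 2 ∨ 2 ∣ N) →
      ¬ ((p : ℤ) ∣ padicValRat q₀ W.Δ) →
    (∀ ρ : ModPGaloisRep K (ZMod p) 2, (W.baseChange K).IsTorsionGaloisRep p ρ →
      FramedRep.IsAbsolutelyIrreducible ρ) →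
    κ₁.IsCyclotomic → κ₂.IsAnticyclotomic →
    ∀ (Ω δ : ℂ) (Ωp : (unrIntegers p)ˣ) (LK G : PowerSeries (PowerSeries (PadicComplexInt p))),
      Ω ≠ 0 → (δ ^ 2 = (NumberField.discr K : ℂ) ∨ δ ^ 2 = -(NumberField.discr K : ℂ)) →
      IsKatzMeasure₂ ι v vbar ∅ κ₁ κ₂ γ₁⁻¹ γ₂⁻¹ 1 Ω δ ((Ωp : unrIntegers p) : PadicComplex p) LK →
      IsGreenbergLFunctionAnyRoot₂ ι v vbar κ₁ κ₂ γ₁⁻¹ γ₂⁻¹ f (NumberField.discr K).natAbs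
        (NumberField.classNumber K) LK G →
    ∀ J : ℤ_[p] →+* PadicComplexInt p,
      (∀ x : ℤ_[p], ((J x : PadicComplexInt p) : PadicComplex p) = ((x : ℚ_[p]) : PadicComplex p)) →
    ∀ ε : ℤˣ,
    ∃ xi Lsig : PowerSeries (PowerSeries (PadicComplexInt p)),
      (∃ (S : Brandt.XiSetup (N / q₀) q₀) (_ : Fintype (Brandt.ClassSet S.O))
          (φ : Brandt.ClassSet S.O → ℤ) (T : GrossPointTower K S p),
          φ ≠ 0 ∧
          Brandt.eigenLattice (N / q₀ * q₀) (Brandt.matrix S.O) (fun n => W.LFunction n) = ℤ ∙ φ ∧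
          (T.HasMuZeroLAc p φ → GreenbergVatsal2000.HasUnitContent (UnrSeries₂.minus Lsig))) ∧
      (Ideal.span {xi * G} =
          (WeierstrassCurve.XGr₂.charIdeal (W.baseChange K) p κ₁ κ₂ vbar γ₁ γ₂).map
              (IwasawaAlgebra₂.toUnr₂ p J) * Ideal.span {Lsig} ∧
      ∀ (κ : ZpExtension ℚ p) (γ : absoluteGaloisGroup ℚ), κ.IsCyclotomic → κ.IsTopGenerator γ →
        IsCyclotomicVariable p γ →
        (∃ ζ : ℤ_[p]ˣ, IsOfFinOrder ζ ∧
          GaloisRep.cyclotomicCharacter ℚ p γ * ζ = GaloisRep.cyclotomicCharacter K p γ₁) →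
        ∀ (W₂ : WeierstrassCurve ℚ) [W₂.IsElliptic] [W₂.IsGloballyMinimal]
          (C₂ : WeierstrassCurve.VariableChange ℚ),
          C₂ • W₂ = W.quadraticTwist (NumberField.discr K : ℚ) →
          (∀ (D₁ : Kobayashi2003.SignedSelmerDualData W κ γ ε)
              (D₂ : Kobayashi2003.SignedSelmerDualData W₂ κ γ ε) (g₁ g₂ : IwasawaAlgebra p),
              D₁.charIdeal = Ideal.span {g₁} → D₂.charIdeal = Ideal.span {g₂} →
              UnrSeries₂.plus xi ∣ PowerSeries.map J (g₁ * g₂)) ∧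
          (∀ {N₂ : ℕ} [NeZero N₂] (f₂ : CuspForm (Gamma0 N₂) 2), IsNewformOf W₂ f₂ →
            ∀ (L₁ L₂ : IwasawaAlgebra p), Kobayashi2003.IsSignedPAdicLFunction f p ε L₁ →
              Kobayashi2003.IsSignedPAdicLFunction f₂ p ε L₂ →
              ∃ u : PowerSeries (PadicComplexInt p), IsUnit u ∧
                UnrSeries₂.plus Lsig = u * PowerSeries.map J (L₁ * L₂))) :=
  Summit.BirchSwinnertonDyer.BirchSwinnertonDyer.Theorems.SemistableDefmuMuCarrierPinned.definitePackageMuCarrier_of_pinned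
    stub_preprintInputs.2.2 stub_publishedInputs.2.2.1 stub_publishedInputs.2.2.2.1

/-- **v4's `stub_acMuInput` (signature VERBATIM) CLOSED by name**: conjunct 7 of `stub_publishedInputs` (Pollack–Weston 2011 Thm. 2.5 (i)).
[cite: PollackWeston2011, Thm. 2.5 (i)] -/
theorem acMuInput_closed :
    ∀ (K : Type) [Field K] [NumberField K] {Nplus Nminus : ℕ} (S : Brandt.XiSetup Nplus Nminus)
      (p : ℕ) [Fact p.Prime] (W : WeierstrassCurve ℚ), pollackWeston2011_thm_2_5_hasMuZeroLAc K S p W :=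
  stub_publishedInputs.2.2.2.2.2.2

/-- **v4's `stub_namedInputsTwo` (signature VERBATIM) CLOSED by name**: its conjuncts from the two cite stubs, the period unit
`realPeriodRat_eq_unit_mul_plusPeriod` being a tree THEOREM given Mazur 1978 Cor. 4.1 (`SkinnerUrban2014.realPeriodRat_eq_unit_mul_plusPeriod_of_mazur`;
the same shape as the INPUTS desk's `InputsNamedTwo.namedInputsTwo_of_mazur`, p640651, which is not imported — it sits in the Theses cone).
[cite: Mazur1978, Cor. 4.1] [cite: Kobayashi2003, Thm. 1.2, Thm. 4.1] [claim: BurungaleSkinnerTianWan2024, status: under-review] -/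
theorem namedInputsTwo_closed :
    (thm617_exists_isGreenbergLFunctionAnyRoot₂_supersingular_PRE ∧
  Kobayashi2003.thm12_signedSelmerDual_finite_torsion ∧ Kobayashi2003.thm41_signedCharIdeal_divisibility ∧
  nonempty_modularParametrizationData ∧ realPeriodRat_eq_unit_mul_plusPeriod) ∧
  thm924_greenberg_dvd_charIdealXGr₂_awayFromCyc_OPEN :=
  ⟨⟨stub_preprintInputs.1, stub_publishedInputs.1, stub_publishedInputs.2.1, stub_publishedInputs.2.2.1,
      Literature.NumberTheory.EllipticCurves.SkinnerUrban2014.realPeriodRat_eq_unit_mul_plusPeriod_of_mazur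
        stub_publishedInputs.2.2.2.2.1⟩,
    stub_preprintInputs.2.1⟩

/-- **v1–v5's `stub_threeResidual` (S7, the `p = 3` half; signature VERBATIM) CLOSED by name** from the two cite stubs and the two
print stubs: `SemistableDefmuOddPrime.threeResidual_of_citePacks` (the «defmu at an odd prime» series, p723224 / p723658 / part 3). The
line's mechanism runs at `p = 3`: S1aʳ/S1bʳ/descent need only `p ≠ 2`, the period unit comes from Mazur Cor. 4.1, BSTW 9.24 / 10.5 (def) /
PW 2.5 are typed at `p ≠ 2`; what is specific to `3` is 6.17 at `3` (flagged) and PW Lemma 2.1 at `3`.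
[claim: BurungaleSkinnerTianWan2024, status: under-review] [cite: BurungaleSkinnerTianWan2024, Thm. 1.3 (p = 3)] [cite: PollackWeston2011, §2.1 Lemma 2.1] -/
theorem threeResidual_closed :
  ∀ (W : WeierstrassCurve ℚ) [W.IsElliptic] [W.IsGloballyMinimal], Rank1Residual.ClassX6 W 3 →
    ∃ ε : ℤˣ, Summit.BirchSwinnertonDyer.Rank1Residual.Supersingular.KobayashiLowerDivisibility W 3 ε :=
  Summit.BirchSwinnertonDyer.BirchSwinnertonDyer.Theorems.SemistableDefmuOddPrime.threeResidual_of_citePacks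
    stub_publishedInputs stub_preprintInputs stub_bstw617OddPrime stub_pollackWestonLemma21

end Closed

/-- **Line «defmu» (v6) closes crux 2 BY NAME from its four registered stubs** through the landed `Theorems` assembly: the v4 body
`SemistableDefmuMuCarrierV4.kobayashiLowerHalfSemistable_body_of_stubs₅` at the five in-file `…_closed` theorems (typed print BY NAME from the
two cite stubs; the two untyped print statements from the two print stubs) — the same term as
`SemistableDefmuOddPrime.kobayashiLowerHalfSemistable_body_of_citePacks_odd stub_publishedInputs stub_preprintInputs stub_bstw617OddPrime
stub_pollackWestonLemma21`. The ONLY theorem of this file concluding the route decl. -/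
theorem KobayashiLowerHalfSemistable_of :
    Summit.BirchSwinnertonDyer.BirchSwinnertonDyer.Theses.SignedLowerHalves.KobayashiLowerHalfSemistable :=
  Summit.BirchSwinnertonDyer.BirchSwinnertonDyer.Theorems.SemistableDefmuMuCarrierV4.kobayashiLowerHalfSemistable_body_of_stubs₅
    ramifiedLevelPrimeR_closed definitePackageMuCarrier_closed acMuInput_closed namedInputsTwo_closed threeResidual_closed

end Summit.BirchSwinnertonDyer.BirchSwinnertonDyer.Cruxes.KobayashiLowerHalfSemistable.DefanchorLine

end
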